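import Summits.AnomalousDissipation.AnomalousDissipation.Theorems.TwoAndHalfDTwohalfdNegRegularCondensateSelection

/-!
# Finite-mode condensation corollary for the crux `TwoAndHalfD.TwohalfdNeg` (stmt-AnomalousDissipation-0211):
# stub FM-SEL `stub_fmSelection` — good blocks with energy control

Line `log-kantorovich-enstrophy-transfer`, lead c7, wave 3 (finite-mode condensation corollary of the regular-condensate
theorem: the comparison flow is the Fourier truncation `P_K v` of the Leray–Hopf flow, clamped to a good block). This
file closes the registered stub FM-SEL, the energy-controlled variant of the landed RC-SEL
(`Theorems/TwoAndHalfDTwohalfdNegRegularCondensateSelection`, whose block calculus it reuses). Fix one level: `κ > 0`,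
a global planar Leray–Hopf flow `v` under a steady smooth mean-zero force `g`, a global weak sourced scalar `θ` over
it (steady smooth mean-zero source `h`, `L²` datum), a comparison flow `W` that is only jointly continuous on
`(0, ∞) × T²` and bounded on `t > 0`, a block length `S > 0`, a floor `2ε < ⟨κ‖∇θ‖²⟩`, ceilings `⟨‖θ‖²⟩ < Eθ`,
`⟨∫‖v‖²⟩ < Ev`, `⟨∫‖v - W‖²⟩ < δ`, and a conull set `G ⊆ (0, ∞)` of admissible starting times. Then some block
`(a, a + S]`, `a ∈ G`, has power `≥ εS/2`, variance mass `≤ Λ' Eθ S`, fluctuation mass `≤ Λ' δ S`, starting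
variance `≤ Λ' Eθ`, velocity energy mass `≤ Λ' Ev S` and starting energy `∫‖v(a)‖² ≤ Λ' Ev`,
`Λ' = 256 (∫h²) Eθ/ε² + 8`.

Proof. (1) Real-variable half (`Selection.exists_good_block`, PDE-free), as in RC-SEL with FIVE penalties of
weight `ε/8`: for `P` (power), `E ≥ 0` (variance), `F ≥ 0` (fluctuation), `Ke ≥ 0` (kinetic energy) integrable on
every `(0, T]`, the block functionals `X(a) = ∫_{(a,a+S]} P`, `V`, `Fl`, `Ve` are backward windows, so
`∫₀ᴺ V ≤ S∫₀^{N+S} E`, `∫₀ᴺ Fl ≤ S∫₀^{N+S} F`, `∫₀ᴺ Ve ≤ S∫₀^{N+S} Ke` and `∫₀ᴺ X ≥ S · min_{[N,N+S]} Π - ∫₀^S Π`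
(`Π = ∫₀ P`). The PENALISED functional
`Ψ = X - (ε/8Eθ)V - (ε/8δ)Fl - (εS/8Eθ)E - (ε/8Ev)Ve - (εS/8Ev)Ke` has `∫₀ᴺ Ψ > (εS/2)N`, so `Ψ > εS/2` on a
set of positive measure, which meets `G`; there the floor holds and, with the block Cauchy–Schwarz bound
`X² ≤ S(∫h²)V`, the five ceilings follow with constants `64(∫h²)Eθ/ε² ≤ Λ'` (`good_of_penalized`).
(2) PDE inputs: as in RC-SEL, plus the kinetic energy `Ke = ∫‖v‖²` (integrable on every `(0, T]`,
`IsGlobalLerayHopf.integrableOn_integral_norm_sq`; honest running means,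
`IsGlobalLerayHopf.isBoundedUnder_timeMean_energy`), and the fluctuation `F = ∫‖v - W‖²` for a comparison flow
that is only continuous on the open set `(0, ∞) × T²` (jointly measurable on `(0, T) × T²` by `ContinuousOn` on a
measurable set; bounded on `t > 0` through the honest `L^∞L²` bound). The horizon `N` is chosen with the dissipation
mean `> 2ε` and the variance / fluctuation / energy means below their ceilings at `N` and `N + S`.
Supports stmt-AnomalousDissipation-0211. [cite: DoeringFoias2002, §2] for the budgets; the rest is [folklore].
-/

namespace Summit.AnomalousDissipation.AnomalousDissipation.Theorems.TwohalfdNeg.FiniteModeCondensate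

open MeasureTheory Filter Topology Set
open scoped ENNReal NNReal InnerProductSpace
open Literature.Analysis.FunctionSpaces Literature.Analysis.FluidPDE

-- `Summit.<Summit>.<Problem>` is the mandated summit-side namespace (CONVENTIONS §2); for this single-conjunct
-- summit the two components coincide, so the duplicate namespace is deliberate.
set_option linter.dupNamespace false

namespace Selection

open Summit.AnomalousDissipation.AnomalousDissipation.Theorems.TwohalfdNeg.RegularCondensate.Selection
  (intervalIntegrable_block integral_block_le le_integral_block sq_block_le)

/-! ## Real-variable half: penalised selection with five penalties -/

/-- Real arithmetic of one good starting time, five penalties: if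
`X > εS/2 + (ε/8Eθ) V + (ε/8δ) Fl + (εS/8Eθ) Z + (ε/8Ev) Ve + (εS/8Ev) Ze` with `V, Fl, Z, Ve, Ze ≥ 0` and
`X² ≤ S H V`, then `X ≥ εS/2`, `V ≤ 64 S H Eθ²/ε²`, `Fl ≤ 64 S H Eθ δ/ε²`, `Z ≤ 64 H Eθ²/ε²`, `Ve ≤ 64 S H Eθ Ev/ε²`,
`Ze ≤ 64 H Eθ Ev/ε²` (all through `X ≤ 8 S H Eθ/ε`). [folklore] -/
theorem good_of_penalized {X V Fl Z Ve Ze S H ε Eθ Ev δ : ℝ} (hS : 0 < S) (hε : 0 < ε) (hEθ : 0 < Eθ) (hEv : 0 < Ev)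
    (hδ : 0 < δ) (hH : 0 ≤ H) (hV : 0 ≤ V) (hFl : 0 ≤ Fl) (hZ : 0 ≤ Z) (hVe : 0 ≤ Ve) (hZe : 0 ≤ Ze)
    (hΨ : ε * S / 2 < X - ε / (8 * Eθ) * V - ε / (8 * δ) * Fl - ε * S / (8 * Eθ) * Z - ε / (8 * Ev) * Ve -
      ε * S / (8 * Ev) * Ze) (hCS : X ^ 2 ≤ S * H * V) :
    ε / 2 * S ≤ X ∧ V ≤ 64 * S * H * Eθ ^ 2 / ε ^ 2 ∧ Fl ≤ 64 * S * H * Eθ * δ / ε ^ 2 ∧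
      Z ≤ 64 * H * Eθ ^ 2 / ε ^ 2 ∧ Ve ≤ 64 * S * H * Eθ * Ev / ε ^ 2 ∧ Ze ≤ 64 * H * Eθ * Ev / ε ^ 2 := by
  have h1 : 0 ≤ ε / (8 * Eθ) * V := by positivity
  have h2 : 0 ≤ ε / (8 * δ) * Fl := by positivity
  have h3 : 0 ≤ ε * S / (8 * Eθ) * Z := by positivity
  have h4 : 0 ≤ ε / (8 * Ev) * Ve := by positivity
  have h5 : 0 ≤ ε * S / (8 * Ev) * Ze := by positivity
  have hεS : 0 < ε * S := mul_pos hε hS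
  have hX0 : 0 ≤ X := by linarith
  -- the scale `M = S H (8Eθ/ε)`: with `t = (ε/8Eθ) V ≤ X` and `X² ≤ S H V = M t` we get `t ≤ M` and `X ≤ M`
  set M : ℝ := S * H * (8 * Eθ / ε) with hM
  have hM0 : 0 ≤ M := by positivity
  have ht : ε / (8 * Eθ) * V ≤ X := by linarith
  have hXt : X ^ 2 ≤ M * (ε / (8 * Eθ) * V) := by
    calc X ^ 2 ≤ S * H * V := hCS
      _ = S * H * (8 * Eθ / ε) * (ε / (8 * Eθ) * V) := by field_simp
  have htM : ε / (8 * Eθ) * V ≤ M := by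
    rcases h1.eq_or_lt with h0 | hpos
    · rw [← h0]; exact hM0
    · have : (ε / (8 * Eθ) * V) * (ε / (8 * Eθ) * V) ≤ M * (ε / (8 * Eθ) * V) := by
        nlinarith [pow_le_pow_left₀ h1 ht 2]
      exact le_of_mul_le_mul_right this hpos
  have hXM : X ≤ M := (pow_le_pow_iff_left₀ hX0 hM0 two_ne_zero).1 (by nlinarith)
  refine ⟨by linarith, ?_, ?_, ?_, ?_, ?_⟩
  · calc V = 8 * Eθ / ε * (ε / (8 * Eθ) * V) := by field_simp
      _ ≤ 8 * Eθ / ε * M := mul_le_mul_of_nonneg_left htM (by positivity)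
      _ = 64 * S * H * Eθ ^ 2 / ε ^ 2 := by rw [hM]; field_simp; ring
  · calc Fl = 8 * δ / ε * (ε / (8 * δ) * Fl) := by field_simp
      _ ≤ 8 * δ / ε * M := mul_le_mul_of_nonneg_left (by linarith) (by positivity)
      _ = 64 * S * H * Eθ * δ / ε ^ 2 := by rw [hM]; field_simp; ring
  · calc Z = 8 * Eθ / (ε * S) * (ε * S / (8 * Eθ) * Z) := by field_simp
      _ ≤ 8 * Eθ / (ε * S) * M := mul_le_mul_of_nonneg_left (by linarith) (by positivity)
      _ = 64 * H * Eθ ^ 2 / ε ^ 2 := by rw [hM]; field_simp; ring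
  · calc Ve = 8 * Ev / ε * (ε / (8 * Ev) * Ve) := by field_simp
      _ ≤ 8 * Ev / ε * M := mul_le_mul_of_nonneg_left (by linarith) (by positivity)
      _ = 64 * S * H * Eθ * Ev / ε ^ 2 := by rw [hM]; field_simp; ring
  · calc Ze = 8 * Ev / (ε * S) * (ε * S / (8 * Ev) * Ze) := by field_simp
      _ ≤ 8 * Ev / (ε * S) * M := mul_le_mul_of_nonneg_left (by linarith) (by positivity)
      _ = 64 * H * Eθ * Ev / ε ^ 2 := by rw [hM]; field_simp; ring

/-- **Penalised sliding-block selection, five penalties.** `P`, `E ≥ 0`, `F ≥ 0`, `Ke ≥ 0` integrable on every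
`(0, T]`; the block Cauchy–Schwarz bound `(∫_{(a,a+S]} P)² ≤ S H ∫_{(a,a+S]} E` (`a ≥ 0`); a horizon `N > 0` with the
primitive floor `2εN - C₀ ≤ ∫₀ᵗ P` on `[N, N+S]`, `∫₀ᴺ E ≤ Eθ N`, `∫₀^{N+S} E ≤ Eθ (N+S)`, `∫₀^{N+S} F ≤ δ (N+S)`,
`∫₀ᴺ Ke ≤ Ev N`, `∫₀^{N+S} Ke ≤ Ev (N+S)` and `(3/8)εS² + S C₀ + |∫₀^S Π| < (7/8) ε S N`; a conull `G ⊆ (0,∞)`. Then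
some `a ∈ G`, `a > 0`, opens a good block: `∫_{(a,a+S]} P ≥ εS/2`, `∫_{(a,a+S]} E ≤ 64 S H Eθ²/ε²`,
`∫_{(a,a+S]} F ≤ 64 S H Eθ δ/ε²`, `E(a) ≤ 64 H Eθ²/ε²`, `∫_{(a,a+S]} Ke ≤ 64 S H Eθ Ev/ε²`, `Ke(a) ≤ 64 H Eθ Ev/ε²`.
[folklore] -/
theorem exists_good_block {P E F Ke : ℝ → ℝ} {G : Set ℝ} {S N ε Eθ Ev δ C₀ H : ℝ} (hS : 0 < S) (hN : 0 < N)
    (hε : 0 < ε) (hEθ : 0 < Eθ) (hEv : 0 < Ev) (hδ : 0 < δ) (hH : 0 ≤ H) (hPi : ∀ T, IntegrableOn P (Ioc 0 T))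
    (hEi : ∀ T, IntegrableOn E (Ioc 0 T)) (hFi : ∀ T, IntegrableOn F (Ioc 0 T))
    (hKi : ∀ T, IntegrableOn Ke (Ioc 0 T)) (hE0 : ∀ t, 0 ≤ E t) (hF0 : ∀ t, 0 ≤ F t) (hK0 : ∀ t, 0 ≤ Ke t)
    (hCS : ∀ a, 0 ≤ a → (∫ t in Ioc a (a + S), P t) ^ 2 ≤ S * H * ∫ t in Ioc a (a + S), E t)
    (hfloor : ∀ t ∈ Icc N (N + S), 2 * ε * N - C₀ ≤ ∫ s in (0 : ℝ)..t, P s) (hEN : ∫ s in (0 : ℝ)..N, E s ≤ Eθ * N)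
    (hET : ∫ s in (0 : ℝ)..(N + S), E s ≤ Eθ * (N + S)) (hFT : ∫ s in (0 : ℝ)..(N + S), F s ≤ δ * (N + S))
    (hKN : ∫ s in (0 : ℝ)..N, Ke s ≤ Ev * N) (hKT : ∫ s in (0 : ℝ)..(N + S), Ke s ≤ Ev * (N + S))
    (hlarge : 3 * ε * S ^ 2 / 8 + S * C₀ + |∫ t in (0 : ℝ)..S, ∫ s in (0 : ℝ)..t, P s| < 7 / 8 * ε * S * N)
    (hG : ∀ᵐ a ∂(volume.restrict (Ioi (0 : ℝ))), a ∈ G) :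
    ∃ a ∈ G, 0 < a ∧ ε / 2 * S ≤ ∫ t in Ioc a (a + S), P t ∧ ∫ t in Ioc a (a + S), E t ≤ 64 * S * H * Eθ ^ 2 / ε ^ 2 ∧
      ∫ t in Ioc a (a + S), F t ≤ 64 * S * H * Eθ * δ / ε ^ 2 ∧ E a ≤ 64 * H * Eθ ^ 2 / ε ^ 2 ∧
      ∫ t in Ioc a (a + S), Ke t ≤ 64 * S * H * Eθ * Ev / ε ^ 2 ∧ Ke a ≤ 64 * H * Eθ * Ev / ε ^ 2 := by
  set μ₁ : ℝ := ε / (8 * Eθ) with hμ₁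
  set μ₂ : ℝ := ε / (8 * δ) with hμ₂
  set μ₃ : ℝ := ε * S / (8 * Eθ) with hμ₃
  set μ₄ : ℝ := ε / (8 * Ev) with hμ₄
  set μ₅ : ℝ := ε * S / (8 * Ev) with hμ₅
  have iX := intervalIntegrable_block hPi hS.le hN.le
  have iV := intervalIntegrable_block hEi hS.le hN.le
  have iF := intervalIntegrable_block hFi hS.le hN.le
  have iW := intervalIntegrable_block hKi hS.le hN.le
  have iZ : IntervalIntegrable E volume 0 N := AgeDecoupling.intervalIntegrable_of_forall_integrableOn hEi le_rfl hN.le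
  have iY : IntervalIntegrable Ke volume 0 N := AgeDecoupling.intervalIntegrable_of_forall_integrableOn hKi le_rfl hN.le
  -- the averaged bounds and the integral of the penalised functional
  have bX := le_integral_block hPi hS.le hN.le hfloor
  have bV := integral_block_le hEi hE0 hS.le hN.le
  have bF := integral_block_le hFi hF0 hS.le hN.le
  have bW := integral_block_le hKi hK0 hS.le hN.le
  have i4 := ((iX.sub (iV.const_mul μ₁)).sub (iF.const_mul μ₂)).sub (iZ.const_mul μ₃)
  have hΨ : ∫ a in (0 : ℝ)..N, ((∫ t in Ioc a (a + S), P t) - μ₁ * (∫ t in Ioc a (a + S), E t) -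
      μ₂ * (∫ t in Ioc a (a + S), F t) - μ₃ * E a - μ₄ * (∫ t in Ioc a (a + S), Ke t) - μ₅ * Ke a) =
      (∫ a in (0 : ℝ)..N, ∫ t in Ioc a (a + S), P t) - μ₁ * (∫ a in (0 : ℝ)..N, ∫ t in Ioc a (a + S), E t) -
        μ₂ * (∫ a in (0 : ℝ)..N, ∫ t in Ioc a (a + S), F t) - μ₃ * (∫ a in (0 : ℝ)..N, E a) -
        μ₄ * (∫ a in (0 : ℝ)..N, ∫ t in Ioc a (a + S), Ke t) - μ₅ * ∫ a in (0 : ℝ)..N, Ke a := by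
    rw [intervalIntegral.integral_sub (i4.sub (iW.const_mul μ₄)) (iY.const_mul μ₅),
      intervalIntegral.integral_sub i4 (iW.const_mul μ₄),
      intervalIntegral.integral_sub ((iX.sub (iV.const_mul μ₁)).sub (iF.const_mul μ₂)) (iZ.const_mul μ₃),
      intervalIntegral.integral_sub (iX.sub (iV.const_mul μ₁)) (iF.const_mul μ₂),
      intervalIntegral.integral_sub iX (iV.const_mul μ₁), intervalIntegral.integral_const_mul,
      intervalIntegral.integral_const_mul, intervalIntegral.integral_const_mul, intervalIntegral.integral_const_mul,
      intervalIntegral.integral_const_mul]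
  have hpen : μ₁ * (∫ a in (0 : ℝ)..N, ∫ t in Ioc a (a + S), E t) + μ₂ * (∫ a in (0 : ℝ)..N, ∫ t in Ioc a (a + S), F t) +
      μ₃ * (∫ a in (0 : ℝ)..N, E a) + μ₄ * (∫ a in (0 : ℝ)..N, ∫ t in Ioc a (a + S), Ke t) +
      μ₅ * (∫ a in (0 : ℝ)..N, Ke a) ≤ 5 / 8 * ε * S * N + 3 * ε * S ^ 2 / 8 := by
    have p1 : μ₁ * (∫ a in (0 : ℝ)..N, ∫ t in Ioc a (a + S), E t) ≤ μ₁ * (S * (Eθ * (N + S))) :=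
      mul_le_mul_of_nonneg_left (bV.trans (mul_le_mul_of_nonneg_left hET hS.le)) (by positivity)
    have p2 : μ₂ * (∫ a in (0 : ℝ)..N, ∫ t in Ioc a (a + S), F t) ≤ μ₂ * (S * (δ * (N + S))) :=
      mul_le_mul_of_nonneg_left (bF.trans (mul_le_mul_of_nonneg_left hFT hS.le)) (by positivity)
    have p3 : μ₃ * (∫ a in (0 : ℝ)..N, E a) ≤ μ₃ * (Eθ * N) := mul_le_mul_of_nonneg_left hEN (by positivity)
    have p4 : μ₄ * (∫ a in (0 : ℝ)..N, ∫ t in Ioc a (a + S), Ke t) ≤ μ₄ * (S * (Ev * (N + S))) :=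
      mul_le_mul_of_nonneg_left (bW.trans (mul_le_mul_of_nonneg_left hKT hS.le)) (by positivity)
    have p5 : μ₅ * (∫ a in (0 : ℝ)..N, Ke a) ≤ μ₅ * (Ev * N) := mul_le_mul_of_nonneg_left hKN (by positivity)
    have e : μ₁ * (S * (Eθ * (N + S))) + μ₂ * (S * (δ * (N + S))) + μ₃ * (Eθ * N) + μ₄ * (S * (Ev * (N + S))) +
        μ₅ * (Ev * N) = 5 / 8 * ε * S * N + 3 * ε * S ^ 2 / 8 := by
      rw [hμ₁, hμ₂, hμ₃, hμ₄, hμ₅]; field_simp; ring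
    linarith
  have hK := le_abs_self (∫ t in (0 : ℝ)..S, ∫ s in (0 : ℝ)..t, P s)
  -- if no admissible starting time were good, `Ψ ≤ εS/2` a.e. on `(0, N]`, contradicting `∫₀ᴺ Ψ > (εS/2) N`
  by_contra hcon
  have hae : ∀ᵐ a ∂(volume.restrict (Ioc (0 : ℝ) N)), (∫ t in Ioc a (a + S), P t) -
      μ₁ * (∫ t in Ioc a (a + S), E t) - μ₂ * (∫ t in Ioc a (a + S), F t) - μ₃ * E a -
      μ₄ * (∫ t in Ioc a (a + S), Ke t) - μ₅ * Ke a ≤ ε * S / 2 := by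
    filter_upwards [ae_restrict_of_ae_restrict_of_subset Ioc_subset_Ioi_self hG,
      ae_restrict_mem measurableSet_Ioc] with a haG ha
    by_contra hlt
    push Not at hlt
    obtain ⟨g1, g2, g3, g4, g5, g6⟩ := good_of_penalized hS hε hEθ hEv hδ hH
      (setIntegral_nonneg measurableSet_Ioc fun t _ => hE0 t) (setIntegral_nonneg measurableSet_Ioc fun t _ => hF0 t)
      (hE0 a) (setIntegral_nonneg measurableSet_Ioc fun t _ => hK0 t) (hK0 a) hlt (hCS a ha.1.le)
    exact hcon ⟨a, haG, ha.1, g1, g2, g3, g4, g5, g6⟩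
  have hup := intervalIntegral.integral_mono_ae_restrict hN.le ((i4.sub (iW.const_mul μ₄)).sub (iY.const_mul μ₅))
    intervalIntegrable_const (by rwa [Measure.restrict_congr_set Ioc_ae_eq_Icc] at hae)
  rw [intervalIntegral.integral_const, smul_eq_mul, sub_zero, hΨ] at hup
  linarith

/-! ## PDE half: the fluctuation energy around a comparison flow continuous on `(0, ∞) × T²` -/

section Level

variable {κ : ℝ} {g v₀ : UnitAddTorus (Fin 2) → EuclideanSpace ℝ (Fin 2)}
  {v W : ℝ → UnitAddTorus (Fin 2) → EuclideanSpace ℝ (Fin 2)} {B : ℝ}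

/-- **Honest bound of the fluctuation energy**: along a global Leray–Hopf flow under a steady smooth mean-zero
force, for a comparison flow `W` jointly continuous on `(0, ∞) × T²` with `‖W(t)‖ ≤ B` for `t > 0`, some `R` bounds
`∫‖v(t) - W(t)‖²` for every `t > 0` (`‖a - b‖² ≤ 2‖a‖² + 2‖b‖²` and the uniform energy bound). [folklore] -/
theorem exists_forall_fluct_le_of_continuousOn (hκ : 0 < κ) (hgs : Torus.IsSmooth g) (hgz : Torus.HasZeroMean g)
    (hLH : Torus.IsGlobalLerayHopf κ (fun _ => g) v₀ v) (hW : ContinuousOn (Function.uncurry W) (Ioi 0 ×ˢ univ))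
    (hWB : ∀ t, 0 < t → ∀ x, ‖W t x‖ ≤ B) : ∃ R : ℝ, ∀ t, 0 < t → ∫ x, ‖v t x - W t x‖ ^ 2 ≤ R := by
  obtain ⟨R, hR⟩ := hLH.exists_forall_integral_norm_sq_le_of_hasZeroMean hκ (hgs.memLp 2) hgz
  refine ⟨2 * R + 2 * B ^ 2, fun t ht => ?_⟩
  have hWL2 : MemLp (W t) 2 volume :=
    Condensate.FluctuationMeans.memLp_two_of_continuous (continuousOn_univ.1 (hW.uncurry_left t ht))
  have h1 := Condensate.FluctuationMeans.integral_norm_sub_sq_le_two_mul_add (hLH.memLp_two ht.le) hWL2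
  have h2 : ∫ x, ‖W t x‖ ^ 2 ≤ B ^ 2 := by
    calc ∫ x, ‖W t x‖ ^ 2 ≤ ∫ _, B ^ 2 := integral_mono (hWL2.integrable_norm_pow two_ne_zero) (integrable_const _)
          fun x => pow_le_pow_left₀ (norm_nonneg _) (hWB t ht x) 2
      _ = B ^ 2 := by simp only [integral_const, probReal_univ, one_smul]
  linarith [hR t ht.le]

/-- **The fluctuation energy is integrable on every `(0, T]`** for a comparison flow jointly continuous on
`(0, ∞) × T²` and bounded on `t > 0` (jointly measurable on `(0, T) × T²`, Fubini, bounded). [folklore] -/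
theorem integrableOn_fluct_of_continuousOn (hκ : 0 < κ) (hgs : Torus.IsSmooth g) (hgz : Torus.HasZeroMean g)
    (hLH : Torus.IsGlobalLerayHopf κ (fun _ => g) v₀ v) (hW : ContinuousOn (Function.uncurry W) (Ioi 0 ×ˢ univ))
    (hWB : ∀ t, 0 < t → ∀ x, ‖W t x‖ ≤ B) (T : ℝ) : IntegrableOn (fun t => ∫ x, ‖v t x - W t x‖ ^ 2) (Ioc 0 T) := by
  rcases le_or_gt T 0 with hT | hT
  · rw [Ioc_eq_empty (not_lt.2 hT)]; exact integrableOn_empty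
  obtain ⟨R, hR⟩ := exists_forall_fluct_le_of_continuousOn hκ hgs hgz hLH hW hWB
  have hmeas : AEStronglyMeasurable (fun t => ∫ x, ‖v t x - W t x‖ ^ 2) (volume.restrict (Ioc 0 T)) := by
    have hWm : AEStronglyMeasurable (Function.uncurry W) ((volume.restrict (Ioo 0 T)).prod volume) := by
      rw [Measure.restrict_prod_eq_prod_univ]
      exact (hW.mono (prod_mono Ioo_subset_Ioi_self Subset.rfl)).aestronglyMeasurable
        (measurableSet_Ioo.prod MeasurableSet.univ)
    have h1 : AEStronglyMeasurable (fun p : ℝ × UnitAddTorus (Fin 2) => ‖Function.uncurry v p - Function.uncurry W p‖ ^ 2)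
        ((volume.restrict (Ioo 0 T)).prod volume) :=
      (continuous_pow 2).comp_aestronglyMeasurable ((hLH T hT).aestronglyMeasurable_uncurry.sub hWm).norm
    have h2 : AEStronglyMeasurable (fun t => ∫ x, ‖v t x - W t x‖ ^ 2) (volume.restrict (Ioo 0 T)) :=
      h1.integral_prod_right'
    rwa [Measure.restrict_congr_set Ioo_ae_eq_Ioc] at h2
  refine Integrable.mono' (g := fun _ => R) (integrable_const _) hmeas ?_
  filter_upwards [ae_restrict_mem measurableSet_Ioc] with t ht
  rw [Real.norm_eq_abs, abs_of_nonneg (integral_nonneg fun x => sq_nonneg _)]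
  exact hR t ht.1

end Level

end Selection

set_option maxHeartbeats 400000 in
open Selection RegularCondensate.Selection in
/-- **FM-SEL `stub_fmSelection` — good blocks with energy control** (registered stub of the line
`log-kantorovich-enstrophy-transfer` on stmt-AnomalousDissipation-0211). At one level (`κ > 0`, global planar
Leray–Hopf flow `v` under a steady smooth mean-zero force, global weak sourced scalar `θ` with steady smooth mean-zero
source `h` and `L²` datum, comparison flow `W` jointly continuous on `(0, ∞) × T²` and bounded on `t > 0`, block
length `S > 0`, floor `2ε < ⟨κ‖∇θ‖²⟩`, ceilings `⟨‖θ‖²⟩ < Eθ`, `⟨∫‖v‖²⟩ < Ev`, `⟨∫‖v - W‖²⟩ < δ`, conull admissible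
set `G ⊆ (0,∞)`), some block `(a, a+S]` with `a ∈ G`, `a > 0` has power `≥ εS/2`, variance mass `≤ Λ' Eθ S`,
fluctuation mass `≤ Λ' δ S`, starting variance `≤ Λ' Eθ`, energy mass `≤ Λ' Ev S` and starting energy `≤ Λ' Ev`,
`Λ' = 256 (∫h²) Eθ/ε² + 8`. Proof: honesty of the four running means picks a large horizon `N`; `(H1)`, `(H3)` of
`FluidPDE/SourcedScalarBudget` and the integrability of the six functionals feed the penalised sliding-block
selection `Selection.exists_good_block` (constants `64 (∫h²) Eθ/ε² ≤ Λ'`). [folklore] -/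
theorem stub_fmSelection :
    ∀ (κ : ℝ) (g v₀ : UnitAddTorus (Fin 2) → EuclideanSpace ℝ (Fin 2))
      (v W : ℝ → UnitAddTorus (Fin 2) → EuclideanSpace ℝ (Fin 2))
      (h θ₀ : UnitAddTorus (Fin 2) → ℝ) (θ : ℝ → UnitAddTorus (Fin 2) → ℝ)
      (G : Set ℝ) (ε Eθ Ev δ S B : ℝ),
      0 < κ → Torus.IsSmooth g → Torus.HasZeroMean g → Torus.IsGlobalLerayHopf κ (fun _ => g) v₀ v →
      ContinuousOn (Function.uncurry W) (Set.Ioi 0 ×ˢ Set.univ) → (∀ t, 0 < t → ∀ x, ‖W t x‖ ≤ B) →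
      Torus.IsSmooth h → Torus.HasZeroMean h → MemLp θ₀ 2 volume →
      Torus.IsWeakScalarTransportForced κ v (fun _ => h) θ₀ θ →
      (∀ᵐ a ∂(volume.restrict (Set.Ioi (0 : ℝ))), a ∈ G) →
      0 < ε → 0 < S → 0 < δ →
      2 * ε < longTimeAvgSup (fun t => κ * (Torus.eScalarGradNormSq (θ t)).toReal) →
      longTimeAvgSup (fun t => Torus.scalarL2Sq (θ t)) < Eθ →
      longTimeAvgSup (fun t => ∫ x, ‖v t x‖ ^ 2) < Ev →
      longTimeAvgSup (fun t => ∫ x, ‖v t x - W t x‖ ^ 2) < δ →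
      ∃ a ∈ G, 0 < a ∧
        ε / 2 * S ≤ ∫ t in Set.Ioc a (a + S), ∫ x, θ t x * h x ∧
        ∫ t in Set.Ioc a (a + S), Torus.scalarL2Sq (θ t) ≤ (256 * (∫ x, h x ^ 2) * Eθ / ε ^ 2 + 8) * Eθ * S ∧
        ∫ t in Set.Ioc a (a + S), ∫ x, ‖v t x - W t x‖ ^ 2 ≤ (256 * (∫ x, h x ^ 2) * Eθ / ε ^ 2 + 8) * δ * S ∧
        Torus.scalarL2Sq (θ a) ≤ (256 * (∫ x, h x ^ 2) * Eθ / ε ^ 2 + 8) * Eθ ∧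
        ∫ t in Set.Ioc a (a + S), ∫ x, ‖v t x‖ ^ 2 ≤ (256 * (∫ x, h x ^ 2) * Eθ / ε ^ 2 + 8) * Ev * S ∧
        ∫ x, ‖v a x‖ ^ 2 ≤ (256 * (∫ x, h x ^ 2) * Eθ / ε ^ 2 + 8) * Ev := by
  intro κ g v₀ v W h θ₀ θ G ε Eθ Ev δ S B hκ hgs hgz hLH hWc hWB hhs hhz hθ₀ hθ hG hε hS hδ hD hSlim hKlim hFlim
  have hG' : ∀ T, 0 < T → ∫⁻ t in Ioo 0 T, Torus.eGradNormSq (v t) ^ (1 / 2 : ℝ) < ⊤ := fun T hT =>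
    QuietOfSubLog.lintegral_rpow_half_eGradNormSq_lt_top hLH hT
  have hH0 : 0 ≤ ∫ y, h y ^ 2 := integral_nonneg fun _ => sq_nonneg _
  have hE0 : ∀ t, 0 ≤ Torus.scalarL2Sq (θ t) := fun t => Torus.scalarL2Sq_nonneg _
  have hF0 : ∀ t, 0 ≤ ∫ x, ‖v t x - W t x‖ ^ 2 := fun t => integral_nonneg fun _ => sq_nonneg _
  have hK0 : ∀ t, 0 ≤ ∫ x, ‖v t x‖ ^ 2 := fun t => integral_nonneg fun _ => sq_nonneg _
  have hq0 : ∀ t, 0 ≤ κ * (Torus.eScalarGradNormSq (θ t)).toReal := fun t => mul_nonneg hκ.le ENNReal.toReal_nonneg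
  have hEθ : 0 < Eθ := (longTimeAvgSup_nonneg hE0).trans_lt hSlim
  have hEv : 0 < Ev := (longTimeAvgSup_nonneg hK0).trans_lt hKlim
  -- integrability on every `(0, T]` of the power, the variance, the fluctuation, the energy and the dissipation rate
  have hPi : ∀ T, IntegrableOn (fun t => ∫ x, θ t x * h x) (Ioc 0 T) := fun T => by
    rcases le_or_gt T 0 with hT | hT
    · rw [Ioc_eq_empty (not_lt.2 hT)]; exact integrableOn_empty
    exact (intervalIntegrable_iff_integrableOn_Ioc_of_le hT.le).1 (Condensate.intervalIntegrable_integral_mul hθ hhs.continuous hT)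
  have hEi : ∀ T, IntegrableOn (fun t => Torus.scalarL2Sq (θ t)) (Ioc 0 T) := fun T => by
    rcases le_or_gt T 0 with hT | hT
    · rw [Ioc_eq_empty (not_lt.2 hT)]; exact integrableOn_empty
    exact (Torus.integrableOn_scalarL2Sq hθ hT).1
  have hFi := fun T => integrableOn_fluct_of_continuousOn hκ hgs hgz hLH hWc hWB T
  have hKi : ∀ T, IntegrableOn (fun t => ∫ x, ‖v t x‖ ^ 2) (Ioc 0 T) := fun T => by
    rcases le_or_gt T 0 with hT | hT
    · rw [Ioc_eq_empty (not_lt.2 hT)]; exact integrableOn_empty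
    exact hLH.integrableOn_integral_norm_sq hT
  have hqi : ∀ T, IntegrableOn (fun t => κ * (Torus.eScalarGradNormSq (θ t)).toReal) (Ioc 0 T) := fun T => by
    rcases le_or_gt T 0 with hT | hT
    · rw [Ioc_eq_empty (not_lt.2 hT)]; exact integrableOn_empty
    exact (Torus.integrableOn_dissipationRate hκ hθ hθ₀ hhs hG' hT).1
  -- `(H3)`: `P² ≤ (∫h²) ‖θ‖²` a.e. (the trace is the power a.e.)
  have hPE : ∀ᵐ t ∂(volume.restrict (Ioi (0 : ℝ))), (∫ x, θ t x * h x) ^ 2 ≤ (∫ y, h y ^ 2) * Torus.scalarL2Sq (θ t) := by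
    filter_upwards [Torus.ae_integral_mul_eq_trace hθ hhs, Torus.ae_trace_sq_le hθ hhs] with t h1 h2
    rw [h1]; exact h2
  -- honesty of the four running means and a good horizon `N` beyond the largeness threshold `L`
  obtain ⟨R, hR⟩ := exists_forall_fluct_le_of_continuousOn hκ hgs hgz hLH hWc hWB
  have hFb : IsBoundedUnder (· ≤ ·) atTop (timeMean fun t => ∫ x, ‖v t x - W t x‖ ^ 2) :=
    isBoundedUnder_le_timeMean (C := R) fun t ht => by rw [abs_of_nonneg (hF0 t)]; exact hR t ht
  have hEb := Torus.isBoundedUnder_timeMean_scalarL2Sq hκ hθ hθ₀ hhs hhz hG'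
  have hKb := hLH.isBoundedUnder_timeMean_energy hκ (hgs.memLp 2) hgz
  set K : ℝ := ∫ t in (0 : ℝ)..S, ∫ s in (0 : ℝ)..t, ∫ x, θ s x * h x with hK
  set L : ℝ := (3 * ε * S ^ 2 / 8 + S * (1 / 2 * ∫ y, θ₀ y ^ 2) + |K| + 1) / (7 / 8 * ε * S) with hL
  have hshift : Tendsto (fun N : ℝ => N + S) atTop atTop := tendsto_atTop_add_const_right _ S tendsto_id
  have e1 : ∀ᶠ N in atTop, timeMean (fun t => Torus.scalarL2Sq (θ t)) N < Eθ := eventually_lt_of_limsup_lt hSlim hEb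
  have e2 : ∀ᶠ N in atTop, timeMean (fun t => ∫ x, ‖v t x‖ ^ 2) N < Ev := eventually_lt_of_limsup_lt hKlim hKb
  obtain ⟨N, hqN, hEN, hET, hFT, hKN, hKT, hLN⟩ := ((frequently_lt_of_lt_limsup
    (isCoboundedUnder_le_timeMean_of_nonneg hq0) hD).and_eventually (e1.and ((hshift.eventually e1).and
    ((hshift.eventually (eventually_lt_of_limsup_lt hFlim hFb)).and (e2.and ((hshift.eventually e2).and
    (eventually_ge_atTop (max 1 L)))))))).exists
  have hN : 0 < N := one_pos.trans_le ((le_max_left _ _).trans hLN)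
  have hT : 0 < N + S := by linarith
  have hlarge : 3 * ε * S ^ 2 / 8 + S * (1 / 2 * ∫ y, θ₀ y ^ 2) + |K| < 7 / 8 * ε * S * N := by
    have h1 : L ≤ N := (le_max_right _ _).trans hLN
    rw [hL, div_le_iff₀ (by positivity)] at h1
    linarith
  -- the running means as integrals
  have mEN : ∫ s in (0 : ℝ)..N, Torus.scalarL2Sq (θ s) ≤ Eθ * N := by
    rw [Condensate.intervalIntegral_eq_mul_timeMean _ hN]; nlinarith
  have mET : ∫ s in (0 : ℝ)..(N + S), Torus.scalarL2Sq (θ s) ≤ Eθ * (N + S) := by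
    rw [Condensate.intervalIntegral_eq_mul_timeMean _ hT]; nlinarith
  have mFT : ∫ s in (0 : ℝ)..(N + S), (∫ x, ‖v s x - W s x‖ ^ 2) ≤ δ * (N + S) := by
    rw [Condensate.intervalIntegral_eq_mul_timeMean _ hT]; nlinarith
  have mKN : ∫ s in (0 : ℝ)..N, (∫ x, ‖v s x‖ ^ 2) ≤ Ev * N := by
    rw [Condensate.intervalIntegral_eq_mul_timeMean _ hN]; nlinarith
  have mKT : ∫ s in (0 : ℝ)..(N + S), (∫ x, ‖v s x‖ ^ 2) ≤ Ev * (N + S) := by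
    rw [Condensate.intervalIntegral_eq_mul_timeMean _ hT]; nlinarith
  -- `(H1)` turns the dissipation floor at `N` into a floor for the primitive of the power on `[N, N + S]`
  have hfloor : ∀ t ∈ Icc N (N + S), 2 * ε * N - 1 / 2 * (∫ y, θ₀ y ^ 2) ≤ ∫ s in (0 : ℝ)..t, ∫ x, θ s x * h x := by
    intro t ht
    have ht0 : 0 < t := hN.trans_le ht.1
    have h1 := Torus.intervalIntegral_dissipationRate_le hκ hθ hθ₀ hhs hG' ht0
    have h2 : ∫ s in (0 : ℝ)..t, ((∫ y, θ₀ y * h y) + ∫ τ in Ioc 0 s, ((∫ y, θ τ y *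
        (⟪v τ y, Torus.gradient h y⟫_ℝ + κ * Torus.laplacian h y)) + ∫ y, h y * h y)) = ∫ s in (0 : ℝ)..t, ∫ x, θ s x * h x := by
      rw [intervalIntegral.integral_of_le ht0.le, intervalIntegral.integral_of_le ht0.le]
      exact (integral_congr_ae (ae_restrict_of_ae_restrict_of_subset Ioc_subset_Ioi_self (Torus.ae_integral_mul_eq_trace hθ hhs))).symm
    have h3 : ∫ s in (0 : ℝ)..N, κ * (Torus.eScalarGradNormSq (θ s)).toReal ≤ ∫ s in (0 : ℝ)..t, κ * (Torus.eScalarGradNormSq (θ s)).toReal :=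
      intervalIntegral.integral_mono_interval le_rfl hN.le ht.1 (ae_of_all _ hq0)
        (AgeDecoupling.intervalIntegrable_of_forall_integrableOn hqi le_rfl ht0.le)
    have h4 : 2 * ε * N ≤ ∫ s in (0 : ℝ)..N, κ * (Torus.eScalarGradNormSq (θ s)).toReal := by
      rw [Condensate.intervalIntegral_eq_mul_timeMean _ hN]; nlinarith
    linarith
  -- the penalised selection, then `64 (∫h²) Eθ/ε² ≤ Λ'`
  obtain ⟨a, haG, ha, g1, g2, g3, g4, g5, g6⟩ := exists_good_block hS hN hε hEθ hEv hδ hH0 hPi hEi hFi hKi hE0 hF0 hK0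
    (fun a ha => sq_block_le hPi hEi hPE hS.le ha) hfloor mEN mET mFT mKN mKT hlarge hG
  refine ⟨a, haG, ha, g1, g2.trans (sub_nonneg.1 ?_), g3.trans (sub_nonneg.1 ?_), g4.trans (sub_nonneg.1 ?_),
    g5.trans (sub_nonneg.1 ?_), g6.trans (sub_nonneg.1 ?_)⟩
  · have e : (256 * (∫ y, h y ^ 2) * Eθ / ε ^ 2 + 8) * Eθ * S - 64 * S * (∫ y, h y ^ 2) * Eθ ^ 2 / ε ^ 2 =
        192 * (S * (∫ y, h y ^ 2) * Eθ ^ 2 / ε ^ 2) + 8 * (Eθ * S) := by ring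
    rw [e]; positivity
  · have e : (256 * (∫ y, h y ^ 2) * Eθ / ε ^ 2 + 8) * δ * S - 64 * S * (∫ y, h y ^ 2) * Eθ * δ / ε ^ 2 =
        192 * (S * (∫ y, h y ^ 2) * Eθ * δ / ε ^ 2) + 8 * (δ * S) := by ring
    rw [e]; positivity
  · have e : (256 * (∫ y, h y ^ 2) * Eθ / ε ^ 2 + 8) * Eθ - 64 * (∫ y, h y ^ 2) * Eθ ^ 2 / ε ^ 2 =
        192 * ((∫ y, h y ^ 2) * Eθ ^ 2 / ε ^ 2) + 8 * Eθ := by ring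
    rw [e]; positivity
  · have e : (256 * (∫ y, h y ^ 2) * Eθ / ε ^ 2 + 8) * Ev * S - 64 * S * (∫ y, h y ^ 2) * Eθ * Ev / ε ^ 2 =
        192 * (S * (∫ y, h y ^ 2) * Eθ * Ev / ε ^ 2) + 8 * (Ev * S) := by ring
    rw [e]; positivity
  · have e : (256 * (∫ y, h y ^ 2) * Eθ / ε ^ 2 + 8) * Ev - 64 * (∫ y, h y ^ 2) * Eθ * Ev / ε ^ 2 =
        192 * ((∫ y, h y ^ 2) * Eθ * Ev / ε ^ 2) + 8 * Ev := by ring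
    rw [e]; positivity

end Summit.AnomalousDissipation.AnomalousDissipation.Theorems.TwohalfdNeg.FiniteModeCondensate
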